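import Summits.QuantumFields.GaugeBoot.StrongCouplingPlaquetteSUN
import HarnessLib

/-!
# Strong coupling from the loop equation, VI: the `SU(2)` plaquette through second order, `⟨ū_P⟩ = β_std/4 + O(β_std²)` explicitly (gauge-boot, ADDENDUM 22 part F)

HONEST FRAMING (cell `pub-gaugeboot`, page 1 of every file): the venture produces certified bounds
on lattice expectations at stated coupling, gauge group, dimension and torus size; NOT a mass gap,
NOT a continuum limit, NOT a string tension; NOT Yang–Mills-summit-bearing (barriers
`FixedCouplingUltralocality`, `PerturbativeInvisibility`).  An analytic STRONG-COUPLING statement with explicit,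
volume-independent (crude) constants, valid for every torus side `L ≥ 2` and every real coupling; informative only for
`β_std ≲ 10⁻²`; it certifies no number of CERTIFIED.md (table couplings `β_std ≥ 1`).

## Content (`SU(2)`, fundamental representation, torus `(ℤ/L)^d`, `d ≥ 2`, `L ≥ 2`)

For `SU(2)` the doubly-wound plaquette is NOT small at strong coupling: `tr U² = (tr U)² − 2` and `E[(tr U_P)²] = 1 + O(β)`
(`StrongCouplingPlaquetteSUNPieces`), so the deformation of `P̃₀` by itself contributes `E[(tr U_P)²] − 4 = −3 + O(β)` to the
plaquette equation `(3/2)·E[tr U_P] = −(β/2)·Σ_{ν,ε} g_{ν,ε}`, whence the leading term `E[tr U_P] = β + O(β²)`, i.e.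
`⟨ū_P⟩ = β/2 = β_std/4` (tree coupling `β = β_std/2`) — the familiar `SU(2)` strong-coupling slope (`I₂(β_std)/I₁(β_std) =
β_std/4 + …`).  The other `2d − 3` plaquettes through the edge contribute `O(β)` terms exactly as for `N ≥ 3`.

* ★★★ `abs_wilsonExpectation_meanPlaquette_sub_su_two_le` — for `d ≥ 2`, EVERY `L ≥ 2`, EVERY real tree coupling `β`:
  **`|⟨ū_P⟩_{β,L} − β/2| ≤ (4(d−1)(16d−21)/9)·β²`**;
* ★★★ `abs_plaquetteExpectation_two_sub_le` — **`|plaquetteExpectation 2 D L β_std − β_std/4| ≤ ((D−1)(16D−21)/9)·β_std²`**;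
  `T2` (`D = 4`): `≤ 43β²/3`; `T1` (`D = 3`): `≤ 6β²`.

References: M. Creutz, *Quarks, gluons and lattices* (1983) Ch. 10 (`SU(2)` strong coupling); Yu. Makeenko, *Methods of
contemporary gauge theory* (2002), Problem 12.7; V. Kazakov, Z. Zheng, arXiv:2203.11360 §2.  Everything is `[folklore]`.
-/

noncomputable section

open MeasureTheory Filter Topology NormedSpace
open scoped Matrix.Norms.Frobenius Matrix
open Literature.MathematicalPhysics.QuantumFieldTheory Literature.MathematicalPhysics.QuantumLattice
open Summit.QuantumFields.YangMills.Cruxes.CurvatureAmnesia.WardDefect.SchwingerDyson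

namespace Summit.QuantumFields.GaugeBoot

namespace StrongCoupling

variable {d L : ℕ} [NeZero L]

/-- ★★★ **THE `SU(2)` PLAQUETTE AT STRONG COUPLING THROUGH SECOND ORDER.**  For `d ≥ 2`, every torus side `L ≥ 2` and EVERY
real (tree) coupling `β` (`= β_std/2`): `|⟨ū_P⟩_{β,L} − β/2| ≤ (4(d−1)(16d−21)/9)·β²`. [folklore] -/
theorem abs_wilsonExpectation_meanPlaquette_sub_su_two_le (hL : (1 : ZMod L) ≠ 0) (hd : 2 ≤ d) (β : ℝ) :
    |wilsonExpectation (fundamentalRep (Fin 2)) β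
        (meanPlaquette (d := d) (L := L) (G := Matrix.specialUnitaryGroup (Fin 2) ℂ) (fundamentalRep (Fin 2))) - β / 2| ≤
      4 * ((d : ℝ) - 1) * (16 * (d : ℝ) - 21) / 9 * β ^ 2 := by
  obtain ⟨μ, ν₀, hμν₀⟩ : ∃ μ ν₀ : Fin d, μ ≠ ν₀ := ⟨⟨0, by omega⟩, ⟨1, by omega⟩, by simp [Fin.ext_iff]⟩
  set x : Site d L := fun _ => 0 with hx
  haveI : IsProbabilityMeasure (wilsonMeasure (d := d) (L := L) (fundamentalRep (Fin 2)) β) :=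
    isProbabilityMeasure_wilsonMeasure (d := d) (L := L) _ (fundamentalLatticeRep 2).continuous β
  -- Step 1: the plaquette loop equation (`s = 1`, `N = 2`), restated on the nose
  have hleq := Equipartition.loopEquation_plaqWord (d := d) (L := L) (fundamentalLatticeRep 2) hL β x hμν₀ true 1
    fun i j => sdPair_specialUnitaryGroup 2 β x μ x _ _ (trace_unitDir_one i j)
  simp only [integral_plaqTerm_latticeRep (fundamentalLatticeRep 2)] at hleq
  simp only [fundamentalLatticeRep_N, fundamentalLatticeRep_ρ, Nat.cast_ofNat] at hleq
  have hleq' : ((2 : ℂ) - 1 / 2) * (∫ U, (fundamentalRep (Fin 2) (wordHolonomy U x (plaqWord μ ν₀ true))).trace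
      ∂(wilsonMeasure (d := d) (L := L) (fundamentalRep (Fin 2)) β)) +
      (β / 2 : ℂ) * ∑ ν ∈ Finset.univ.erase μ, ∑ ε : Bool,
        ((∫ U, (fundamentalRep (Fin 2) (wordHolonomy U x (plaqWord μ ν₀ true ++ plaqWord μ ν ε))).trace
            ∂(wilsonMeasure (d := d) (L := L) (fundamentalRep (Fin 2)) β)) -
          (∫ U, (fundamentalRep (Fin 2) (wordHolonomy U x (plaqWord μ ν₀ true ++ (plaqWord μ ν ε).reverse))).trace
            ∂(wilsonMeasure (d := d) (L := L) (fundamentalRep (Fin 2)) β)) -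
          1 / (2 : ℂ) * ((∫ U, (fundamentalRep (Fin 2) (wordHolonomy U x (plaqWord μ ν₀ true))).trace *
              (fundamentalRep (Fin 2) (wordHolonomy U x (plaqWord μ ν ε))).trace
                ∂(wilsonMeasure (d := d) (L := L) (fundamentalRep (Fin 2)) β)) -
            ∫ U, (fundamentalRep (Fin 2) (wordHolonomy U x (plaqWord μ ν₀ true))).trace *
              (fundamentalRep (Fin 2) (wordHolonomy U x (plaqWord μ ν ε).reverse)).trace
                ∂(wilsonMeasure (d := d) (L := L) (fundamentalRep (Fin 2)) β))) = 0 := hleq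
  have hleq2 : (3 : ℂ) * ((∫ U, (fundamentalRep (Fin 2) (wordHolonomy U x (plaqWord μ ν₀ true))).trace
      ∂(wilsonMeasure (d := d) (L := L) (fundamentalRep (Fin 2)) β)) / 2) +
      (β / 2 : ℂ) * ∑ ν ∈ Finset.univ.erase μ, ∑ ε : Bool,
        ((∫ U, (fundamentalRep (Fin 2) (wordHolonomy U x (plaqWord μ ν₀ true ++ plaqWord μ ν ε))).trace
            ∂(wilsonMeasure (d := d) (L := L) (fundamentalRep (Fin 2)) β)) -
          (∫ U, (fundamentalRep (Fin 2) (wordHolonomy U x (plaqWord μ ν₀ true ++ (plaqWord μ ν ε).reverse))).trace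
            ∂(wilsonMeasure (d := d) (L := L) (fundamentalRep (Fin 2)) β)) -
          1 / (2 : ℂ) * ((∫ U, (fundamentalRep (Fin 2) (wordHolonomy U x (plaqWord μ ν₀ true))).trace *
              (fundamentalRep (Fin 2) (wordHolonomy U x (plaqWord μ ν ε))).trace
                ∂(wilsonMeasure (d := d) (L := L) (fundamentalRep (Fin 2)) β)) -
            ∫ U, (fundamentalRep (Fin 2) (wordHolonomy U x (plaqWord μ ν₀ true))).trace *
              (fundamentalRep (Fin 2) (wordHolonomy U x (plaqWord μ ν ε).reverse)).trace
                ∂(wilsonMeasure (d := d) (L := L) (fundamentalRep (Fin 2)) β))) = 0 := by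
    linear_combination hleq'
  -- the special term: `E[tr hol(P̃₀P̃₀⁻¹)] = 2`, `E[tr hol(P̃₀P̃₀)] = a − 2`, `E[tr P̃₀ tr P̃₀⁻¹] = a`
  have htriv : ∫ U, (fundamentalRep (Fin 2)
      (wordHolonomy U x (plaqWord μ ν₀ true ++ (plaqWord μ ν₀ true).reverse))).trace
        ∂(wilsonMeasure (d := d) (L := L) (fundamentalRep (Fin 2)) β) = (2 : ℂ) := by
    have : ∀ U : GaugeConfig d L (Matrix.specialUnitaryGroup (Fin 2) ℂ),
        (fundamentalRep (Fin 2) (wordHolonomy U x (plaqWord μ ν₀ true ++ (plaqWord μ ν₀ true).reverse))).trace = (2 : ℂ) :=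
      fun U => by rw [wordHolonomy_append_reverse, map_one, Matrix.trace_one, Fintype.card_fin]; rfl
    simp_rw [this]
    rw [integral_const, probReal_univ, one_smul]
  have hdouble := integral_trace_double_su_two (d := d) (L := L) β x μ ν₀
  have hrev : ∫ U, (fundamentalRep (Fin 2) (wordHolonomy U x (plaqWord μ ν₀ true))).trace *
      (fundamentalRep (Fin 2) (wordHolonomy U x (plaqWord μ ν₀ true).reverse)).trace
        ∂(wilsonMeasure (d := d) (L := L) (fundamentalRep (Fin 2)) β) =
      ∫ U, (fundamentalRep (Fin 2) (wordHolonomy U x (plaqWord μ ν₀ true))).trace *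
        (fundamentalRep (Fin 2) (wordHolonomy U x (plaqWord μ ν₀ true))).trace
          ∂(wilsonMeasure (d := d) (L := L) (fundamentalRep (Fin 2)) β) := by
    simp_rw [trace_wordHolonomy_plaqWord_reverse_su_two]
  -- Step 2: the pieces
  have ha := norm_integral_trace_sq_sub_one_su_two_le (d := d) (L := L) hL β x hμν₀
  have hν₀A : ν₀ ∈ Finset.univ.erase μ := Finset.mem_erase.2 ⟨fun h => hμν₀ h.symm, Finset.mem_univ _⟩
  have hB : ∀ q : Word d, Word.Avoids x q (x.shift μ, ν₀) → Word.Avoids x q.reverse (x.shift μ, ν₀) → Word.endpoint x q = x →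
      ‖(∫ U, (fundamentalRep (Fin 2) (wordHolonomy U x (plaqWord μ ν₀ true ++ q))).trace
          ∂(wilsonMeasure (d := d) (L := L) (fundamentalRep (Fin 2)) β)) -
        (∫ U, (fundamentalRep (Fin 2) (wordHolonomy U x (plaqWord μ ν₀ true ++ q.reverse))).trace
          ∂(wilsonMeasure (d := d) (L := L) (fundamentalRep (Fin 2)) β)) -
        1 / (2 : ℂ) * ((∫ U, (fundamentalRep (Fin 2) (wordHolonomy U x (plaqWord μ ν₀ true))).trace *
            (fundamentalRep (Fin 2) (wordHolonomy U x q)).trace ∂(wilsonMeasure (d := d) (L := L) (fundamentalRep (Fin 2)) β)) -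
          ∫ U, (fundamentalRep (Fin 2) (wordHolonomy U x (plaqWord μ ν₀ true))).trace *
            (fundamentalRep (Fin 2) (wordHolonomy U x q.reverse)).trace
              ∂(wilsonMeasure (d := d) (L := L) (fundamentalRep (Fin 2)) β))‖ ≤
        16 * ((d : ℝ) - 1) * (2 : ℝ) ^ 2 * |β| / ((2 : ℝ) ^ 2 - 1) := fun q hq hq' hqx => by
    have h := norm_plaqTermIntegral_suN_le (d := d) (L := L) (N := 2) le_rfl hL β x hμν₀ hq hq' hqx
    simp only [Nat.cast_ofNat] at h
    exact h
  have hmain := norm_sub_le_of_loopEquation (d := d) hν₀A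
    (fun ν ε => (∫ U, (fundamentalRep (Fin 2) (wordHolonomy U x (plaqWord μ ν₀ true ++ plaqWord μ ν ε))).trace
        ∂(wilsonMeasure (d := d) (L := L) (fundamentalRep (Fin 2)) β)) -
      (∫ U, (fundamentalRep (Fin 2) (wordHolonomy U x (plaqWord μ ν₀ true ++ (plaqWord μ ν ε).reverse))).trace
        ∂(wilsonMeasure (d := d) (L := L) (fundamentalRep (Fin 2)) β)) -
      1 / (2 : ℂ) * ((∫ U, (fundamentalRep (Fin 2) (wordHolonomy U x (plaqWord μ ν₀ true))).trace *
          (fundamentalRep (Fin 2) (wordHolonomy U x (plaqWord μ ν ε))).trace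
            ∂(wilsonMeasure (d := d) (L := L) (fundamentalRep (Fin 2)) β)) -
        ∫ U, (fundamentalRep (Fin 2) (wordHolonomy U x (plaqWord μ ν₀ true))).trace *
          (fundamentalRep (Fin 2) (wordHolonomy U x (plaqWord μ ν ε).reverse)).trace
            ∂(wilsonMeasure (d := d) (L := L) (fundamentalRep (Fin 2)) β)))
    (Nc := 3)
    (b := (∫ U, (fundamentalRep (Fin 2) (wordHolonomy U x (plaqWord μ ν₀ true))).trace *
        (fundamentalRep (Fin 2) (wordHolonomy U x (plaqWord μ ν₀ true))).trace
          ∂(wilsonMeasure (d := d) (L := L) (fundamentalRep (Fin 2)) β)) - 1)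
    (B := 16 * ((d : ℝ) - 1) * (2 : ℝ) ^ 2 * |β| / ((2 : ℝ) ^ 2 - 1)) (Bb := 8 * ((d : ℝ) - 1) * |β|)
    hleq2 (by simp only [htriv, hdouble, hrev]; ring) ha
    (fun ν hν => by
      obtain ⟨hνν₀, hν'⟩ := Finset.mem_erase.1 hν
      exact hB _ (avoids_plaqWord_true hL x hμν₀ hνν₀) (avoids_plaqWord_true_reverse hL x hμν₀ hνν₀)
        (endpoint_plaqWord x μ ν true))
    (fun ν hν => by
      have hμν : μ ≠ ν := fun h => (Finset.mem_erase.1 hν).1 h.symm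
      exact hB _ (avoids_plaqWord_false hL x hμν₀ hμν) (avoids_plaqWord_false_reverse hL x hμν₀ hμν)
        (endpoint_plaqWord x μ ν false))
  rw [card_univ_erase_real] at hmain
  -- Step 3: real parts: `Re E[tr hol P̃₀] = 2·⟨ū_P⟩`
  have hre := Equipartition.integral_re_trace_plaqWord (d := d) (L := L) (fundamentalLatticeRep 2) β x hμν₀ true
    (by rw [fundamentalLatticeRep_N]; norm_num)
  have hre0 := Equipartition.re_integral_eq (fundamentalLatticeRep 2) β
    (continuous_trace_wordHolonomy (fundamentalLatticeRep 2) x (plaqWord μ ν₀ true))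
  simp only [fundamentalLatticeRep_N, fundamentalLatticeRep_ρ, Nat.cast_ofNat] at hre hre0
  rw [← hre0] at hre
  have hEP : (∫ U, (fundamentalRep (Fin 2) (wordHolonomy U x (plaqWord μ ν₀ true))).trace
      ∂(wilsonMeasure (d := d) (L := L) (fundamentalRep (Fin 2)) β)).re =
      2 * wilsonExpectation (fundamentalRep (Fin 2)) β
        (meanPlaquette (d := d) (L := L) (G := Matrix.specialUnitaryGroup (Fin 2) ℂ) (fundamentalRep (Fin 2))) := hre
  have hreal : ((3 : ℂ) * ((∫ U, (fundamentalRep (Fin 2) (wordHolonomy U x (plaqWord μ ν₀ true))).trace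
      ∂(wilsonMeasure (d := d) (L := L) (fundamentalRep (Fin 2)) β)) / 2) - (β / 2 : ℂ) * 3).re =
      3 * (wilsonExpectation (fundamentalRep (Fin 2)) β
        (meanPlaquette (d := d) (L := L) (G := Matrix.specialUnitaryGroup (Fin 2) ℂ) (fundamentalRep (Fin 2))) - β / 2) := by
    rw [show (β / 2 : ℂ) = ((β / 2 : ℝ) : ℂ) by push_cast; ring]
    have e2 : ((∫ U, (fundamentalRep (Fin 2) (wordHolonomy U x (plaqWord μ ν₀ true))).trace
        ∂(wilsonMeasure (d := d) (L := L) (fundamentalRep (Fin 2)) β)) / 2).re =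
        (∫ U, (fundamentalRep (Fin 2) (wordHolonomy U x (plaqWord μ ν₀ true))).trace
          ∂(wilsonMeasure (d := d) (L := L) (fundamentalRep (Fin 2)) β)).re / 2 := Complex.div_ofNat_re _ 2
    simp only [Complex.sub_re, Complex.mul_re, Complex.ofReal_re, Complex.ofReal_im, mul_zero, sub_zero, zero_mul, e2, hEP,
      Complex.re_ofNat, Complex.im_ofNat]
    ring
  have hkey := (Complex.abs_re_le_norm _).trans hmain
  rw [hreal, abs_mul, abs_of_pos (by norm_num : (0 : ℝ) < 3)] at hkey
  rw [← sq_abs β]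
  refine ((le_div_iff₀' (by norm_num : (0 : ℝ) < 3)).2 hkey).trans (le_of_eq ?_)
  ring

/-- ★★★ **The cell's form, `SU(2)`, second order**: for `D ≥ 2`, every `L ≥ 2` and every real `β_std`,
`|plaquetteExpectation 2 D L β_std − β_std/4| ≤ ((D−1)(16D−21)/9)·β_std²`. [folklore] -/
theorem abs_plaquetteExpectation_two_sub_le {D L : ℕ} [NeZero L] (hL : 2 ≤ L) (hD : 2 ≤ D) (β : ℝ) :
    |plaquetteExpectation 2 D L β - β / 4| ≤ ((D : ℝ) - 1) * (16 * (D : ℝ) - 21) / 9 * β ^ 2 := by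
  have h := abs_wilsonExpectation_meanPlaquette_sub_su_two_le (d := D) (L := L) (zmod_one_ne_zero hL) hD (β / 2)
  unfold plaquetteExpectation
  have e1 : β / (2 : ℕ) = β / 2 := by norm_num
  rw [e1]
  have e2 : β / 2 / 2 = β / 4 := by ring
  rw [e2] at h
  refine h.trans (le_of_eq ?_)
  ring

/-- `T2` (`SU(2)`, `D = 4`): `|plaquetteExpectation 2 4 L β_std − β_std/4| ≤ 43β_std²/3` (every `L ≥ 2`, every real `β_std`).
[folklore] -/
theorem abs_plaquetteExpectation_two_four_sub_le {L : ℕ} [NeZero L] (hL : 2 ≤ L) (β : ℝ) :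
    |plaquetteExpectation 2 4 L β - β / 4| ≤ 43 * β ^ 2 / 3 := by
  have h := abs_plaquetteExpectation_two_sub_le (D := 4) (L := L) hL (by norm_num) β
  norm_num at h
  linarith

/-- `T1` (`SU(2)`, `D = 3`): `|plaquetteExpectation 2 3 L β_std − β_std/4| ≤ 6β_std²`. [folklore] -/
theorem abs_plaquetteExpectation_two_three_sub_le {L : ℕ} [NeZero L] (hL : 2 ≤ L) (β : ℝ) :
    |plaquetteExpectation 2 3 L β - β / 4| ≤ 6 * β ^ 2 := by
  have h := abs_plaquetteExpectation_two_sub_le (D := 3) (L := L) hL (by norm_num) β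
  norm_num at h
  linarith

end StrongCoupling

end Summit.QuantumFields.GaugeBoot

end
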